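import Summits.QuantumFields.YangMills.Theorems.UnitScaleTiltProp7ExactExpansion
import Literature.MathematicalPhysics.QuantumFieldTheory.Balaban1983to89.T3ContinuumYM3Torus
import HarnessLib

/-!
# Route `UnitScaleTilt`, crux K1 child «MinimiserStabilityRegPr» (stmt-QuantumFields-19200), line «route-R», stub P — THE LINEAR-CURL POINCARÉ INEQUALITY OF A
# SUP-SMALL REPRESENTATIVE IMPLIES THE RELATIVE-CURVATURE ONE («for the comb blend nothing is lost», route-R card §2(a))

Cell `ym3-torus` ∕ fleet seat `ym-ust-19200-p1` (gen 10; HUMAN RULING D-0037, YM ladder rung R3).  WHY.  Gen 9's schema (`Prop7BlendClause1`, p583914) asks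
for the ℓ² Poincaré inequality (ii) `Σ_b‖Y_b‖² ≤ C_P·L^{2(K−n)}·Σ_p|C_p(Y)|²_HS` with the transported LINEAR curl `C_p(Y) = Y₁ + U₀(b₁)Y₂U₀(b₁)^* − U₀(b₄)Y₃U₀(b₄)^* − Y₄`,
gen 10's sup-free schema (`Prop7ExactExpansion`, p589874 ∕ p591206) for (ii′) `Σ_b‖Y_b‖² ≤ C_P′·L^{2(K−n)}·Σ_p‖R_p − 1‖²` with the RELATIVE plaquette variable
`R_p = U(∂p)U₀(∂p)^*`.  Since `R_p − 1 = C_p(Y) + (L_p − C_p)(Y) + r_p` with `‖r_p‖ ≤ 2(Σ_{b∈∂p}‖Y_b‖)²` UNCONDITIONALLY (gen 10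
`norm_plaqHol_mul_star_bg_sub_one_sub_lin_le'`) and `‖(L_p − C_p)(Y)‖ ≤ 2‖U₀(∂p) − 1‖(‖Y₃‖ + ‖Y₄‖)` (gen 2 `norm_lin_sub_curl_le`), a representative with
`‖Y_b‖ ≤ s` at a background with plaquettes within `a` of `1` has `Σ_p|C_p(Y)|²_HS ≤ 6Σ_p‖R_p − 1‖² + 12(1536s² + 48a²)Σ_b‖Y_b‖²` (incidence `4d = 12`), so (ii) with
constant `C_P` and `12·C_P·L^{2(K−n)}·(1536s² + 48a²) ≤ ½` give (ii′) with `C_P′ = 12C_P`.  For the blended comb gauge (`Prop7BlendedGauge`, `s = O(ε₀)L^{−(K−n)}`,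
`a = ε₀L^{−2(K−n)}`) the side condition is `ε₀ ≤ a₀` absolute: the fallback line of the route-R card (§3: comb blend + (R) + counting ⇒ (ii)) feeds the sup-free
schema unchanged.

WHAT IS PROVED (sorry-free, no definition).  `norm_covCurl_le` (per plaquette, any `SU(N)`, no hypothesis), `hs_covCurl_le` (`SU(2)`, with `‖Y_b‖ ≤ s`, `‖U₀(∂p)−1‖ ≤ a`),
**`sum_hs_covCurl_le_T3`**, **`relPoincare_of_curlPoincare_T3`**.

HONEST SCOPE.  Bookkeeping over landed expansions; neither Poincaré inequality is proved here; count-neutral helper toward stmt-QuantumFields-19200 (`--supports`).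
Not a claim about the continuum limit or the mass gap.

References: T. Bałaban, CMP 102 (1985) 277–309 [Balaban1985Variational] ((22)–(28) pp.281–282, (141)–(143) p.299); CMP 99 (1985) 389–434
[Balaban1985BackgroundPropagators] ((3.4) p.391).
-/

noncomputable section

open scoped BigOperators Matrix.Norms.L2Operator Matrix

namespace Summit.QuantumFields.YangMills.Theorems.Prop7RelPoincareOfCurl

open Literature.MathematicalPhysics.QuantumFieldTheory.Balaban1983to89
open Literature.MathematicalPhysics.QuantumFieldTheory.Balaban1983to89.T3ContinuumYM3Torus
open Finset
open Summit.QuantumFields.YangMills.Theorems.Prop7CovariantCoercivity (norm_lin_sub_curl_le sum_norm_sq_le_mul_opNorm_sq plaqHol_eq_word)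
open Summit.QuantumFields.YangMills.Theorems.Prop7FlatLocalMin (sum_plaq_bonds_le)
open Summit.QuantumFields.YangMills.Theorems.Prop7ExactExpansion (norm_plaqHol_mul_star_bg_sub_one_sub_lin_le')

variable {P : Params} {j : ℕ} {N : ℕ} [NeZero N]

omit [NeZero N] in
/-- Triangle bookkeeping: `C = Rm − (Rm − L) − (L − C)` with `L − C = −D`. [folklore] -/
theorem norm_le_of_sub_of_sub {Rm L C D : Matrix (Fin N) (Fin N) ℂ} {B₁ B₂ : ℝ} (hr : ‖Rm - L‖ ≤ B₁) (hc : ‖D‖ ≤ B₂) (hLC : L - C = -D) :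
    ‖C‖ ≤ ‖Rm‖ + B₁ + B₂ := by
  have e : C = Rm - (Rm - L) + D := by
    have : C = L + D := by rw [← sub_eq_zero, ← neg_neg D, ← hLC]; abel
    rw [this]; abel
  calc ‖C‖ = ‖Rm - (Rm - L) + D‖ := by rw [← e]
    _ ≤ ‖Rm - (Rm - L)‖ + ‖D‖ := norm_add_le _ _
    _ ≤ ‖Rm‖ + ‖Rm - L‖ + ‖D‖ := by gcongr; exact norm_sub_le _ _
    _ ≤ ‖Rm‖ + B₁ + B₂ := by linarith

/-- Real bookkeeping for the Hilbert–Schmidt step: `2c² ≤ 6ρ² + (1536s² + 48a²)Σy²` from `c ≤ ρ + 2(Σy)² + 2E(y₃+y₄)`, `y_i ≤ s`, `E ≤ a`. [folklore] -/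
theorem hs_bookkeeping {c ρ E y₁ y₂ y₃ y₄ s a : ℝ} (hc0 : 0 ≤ c) (nE : 0 ≤ E)
    (n₁ : 0 ≤ y₁) (n₂ : 0 ≤ y₂) (n₃ : 0 ≤ y₃) (n₄ : 0 ≤ y₄) (s₁ : y₁ ≤ s) (s₂ : y₂ ≤ s) (s₃ : y₃ ≤ s) (s₄ : y₄ ≤ s) (hE : E ≤ a)
    (hc : c ≤ ρ + 2 * (y₁ + y₂ + y₃ + y₄) ^ 2 + 2 * E * (y₃ + y₄)) :
    2 * c ^ 2 ≤ 6 * ρ ^ 2 + (1536 * s ^ 2 + 48 * a ^ 2) * (y₁ ^ 2 + y₂ ^ 2 + y₃ ^ 2 + y₄ ^ 2) := by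
  set S := y₁ + y₂ + y₃ + y₄ with hS
  have hS0 : 0 ≤ S := by positivity
  have hs0 : 0 ≤ s := n₁.trans s₁
  have hS4 : S ≤ 4 * s := by linarith
  have hsq := pow_le_pow_left₀ hc0 hc 2
  have hsq4 : ∀ t₁ t₂ t₃ t₄ : ℝ, (t₁ + t₂ + t₃ + t₄) ^ 2 ≤ 4 * (t₁ ^ 2 + t₂ ^ 2 + t₃ ^ 2 + t₄ ^ 2) := fun t₁ t₂ t₃ t₄ => by
    have e : 4 * (t₁ ^ 2 + t₂ ^ 2 + t₃ ^ 2 + t₄ ^ 2) - (t₁ + t₂ + t₃ + t₄) ^ 2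
        = (t₁ - t₂) ^ 2 + (t₁ - t₃) ^ 2 + (t₁ - t₄) ^ 2 + (t₂ - t₃) ^ 2 + (t₂ - t₄) ^ 2 + (t₃ - t₄) ^ 2 := by ring
    have h0 : 0 ≤ (t₁ - t₂) ^ 2 + (t₁ - t₃) ^ 2 + (t₁ - t₄) ^ 2 + (t₂ - t₃) ^ 2 + (t₂ - t₄) ^ 2 + (t₃ - t₄) ^ 2 := by positivity
    linarith
  have hSS : S ^ 2 ≤ 4 * (y₁ ^ 2 + y₂ ^ 2 + y₃ ^ 2 + y₄ ^ 2) := hsq4 _ _ _ _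
  have hS2 : S ^ 2 ≤ 16 * s ^ 2 := (pow_le_pow_left₀ hS0 hS4 2).trans (le_of_eq (by ring))
  have hS4' : S ^ 4 ≤ 64 * s ^ 2 * (y₁ ^ 2 + y₂ ^ 2 + y₃ ^ 2 + y₄ ^ 2) := by
    rw [show S ^ 4 = S ^ 2 * S ^ 2 by ring]
    calc S ^ 2 * S ^ 2 ≤ (16 * s ^ 2) * (4 * (y₁ ^ 2 + y₂ ^ 2 + y₃ ^ 2 + y₄ ^ 2)) :=
          mul_le_mul hS2 hSS (sq_nonneg _) (by positivity)
      _ = _ := by ring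
  have h34' : ∀ t₁ t₂ t₃ t₄ : ℝ, (t₃ + t₄) ^ 2 ≤ 2 * (t₁ ^ 2 + t₂ ^ 2 + t₃ ^ 2 + t₄ ^ 2) := fun t₁ t₂ t₃ t₄ => by
    have e : 2 * (t₁ ^ 2 + t₂ ^ 2 + t₃ ^ 2 + t₄ ^ 2) - (t₃ + t₄) ^ 2 = 2 * t₁ ^ 2 + 2 * t₂ ^ 2 + (t₃ - t₄) ^ 2 := by ring
    have h0 : 0 ≤ 2 * t₁ ^ 2 + 2 * t₂ ^ 2 + (t₃ - t₄) ^ 2 := by positivity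
    linarith
  have h34 : (y₃ + y₄) ^ 2 ≤ 2 * (y₁ ^ 2 + y₂ ^ 2 + y₃ ^ 2 + y₄ ^ 2) := h34' _ _ _ _
  have hE2 : E ^ 2 ≤ a ^ 2 := pow_le_pow_left₀ nE hE 2
  have hEy : E ^ 2 * (y₃ + y₄) ^ 2 ≤ a ^ 2 * (2 * (y₁ ^ 2 + y₂ ^ 2 + y₃ ^ 2 + y₄ ^ 2)) :=
    mul_le_mul hE2 h34 (sq_nonneg _) (sq_nonneg a)
  have h3sq : ∀ x y z : ℝ, (x + y + z) ^ 2 ≤ 3 * (x ^ 2 + y ^ 2 + z ^ 2) := fun x y z => by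
    have e : 3 * (x ^ 2 + y ^ 2 + z ^ 2) - (x + y + z) ^ 2 = (x - y) ^ 2 + (x - z) ^ 2 + (y - z) ^ 2 := by ring
    have h0 : 0 ≤ (x - y) ^ 2 + (x - z) ^ 2 + (y - z) ^ 2 := by positivity
    linarith
  have h3 : (ρ + 2 * S ^ 2 + 2 * E * (y₃ + y₄)) ^ 2 ≤ 3 * (ρ ^ 2 + (2 * S ^ 2) ^ 2 + (2 * E * (y₃ + y₄)) ^ 2) := h3sq _ _ _
  have h4 : c ^ 2 ≤ 3 * (ρ ^ 2 + 4 * S ^ 4 + 4 * (E ^ 2 * (y₃ + y₄) ^ 2)) := by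
    have := hsq.trans h3
    have e : (2 * S ^ 2) ^ 2 = 4 * S ^ 4 := by ring
    have e' : (2 * E * (y₃ + y₄)) ^ 2 = 4 * (E ^ 2 * (y₃ + y₄) ^ 2) := by ring
    rw [e, e'] at this
    exact this
  have h5 : (1536 * s ^ 2 + 48 * a ^ 2) * (y₁ ^ 2 + y₂ ^ 2 + y₃ ^ 2 + y₄ ^ 2)
      = 24 * (64 * s ^ 2 * (y₁ ^ 2 + y₂ ^ 2 + y₃ ^ 2 + y₄ ^ 2)) + 24 * (a ^ 2 * (2 * (y₁ ^ 2 + y₂ ^ 2 + y₃ ^ 2 + y₄ ^ 2))) := by ring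
  rw [h5]
  linarith [h4, hS4', hEy]

/-- **THE LINEAR CURL AGAINST THE RELATIVE PLAQUETTE, PER PLAQUETTE, NO HYPOTHESIS** (`SU(N)`): with `Y(b) = U(b)U₀(b)^* − 1` and `R_p = U(∂p)U₀(∂p)^*`,
`‖C_p(Y)‖ ≤ ‖R_p − 1‖ + 2(Σ_{b∈∂p}‖Y(b)‖)² + 2‖U₀(∂p) − 1‖(‖Y(b₃)‖ + ‖Y(b₄)‖)`. [cite: Balaban1985Variational, (22)-(28) pp.281-282] -/
theorem norm_covCurl_le (U U₀ : GaugeField P j (Matrix.specialUnitaryGroup (Fin N) ℂ)) (p : Plaq P j) :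
    ‖((U ⟨p.src, p.μ⟩ : Matrix (Fin N) (Fin N) ℂ) * star (U₀ ⟨p.src, p.μ⟩ : Matrix (Fin N) (Fin N) ℂ) - 1)
        + (U₀ ⟨p.src, p.μ⟩ : Matrix (Fin N) (Fin N) ℂ)
            * ((U ⟨p.src.shift p.μ, p.ν⟩ : Matrix (Fin N) (Fin N) ℂ) * star (U₀ ⟨p.src.shift p.μ, p.ν⟩ : Matrix (Fin N) (Fin N) ℂ) - 1)
            * star (U₀ ⟨p.src, p.μ⟩ : Matrix (Fin N) (Fin N) ℂ)
        - (U₀ ⟨p.src, p.ν⟩ : Matrix (Fin N) (Fin N) ℂ)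
            * ((U ⟨p.src.shift p.ν, p.μ⟩ : Matrix (Fin N) (Fin N) ℂ) * star (U₀ ⟨p.src.shift p.ν, p.μ⟩ : Matrix (Fin N) (Fin N) ℂ) - 1)
            * star (U₀ ⟨p.src, p.ν⟩ : Matrix (Fin N) (Fin N) ℂ)
        - ((U ⟨p.src, p.ν⟩ : Matrix (Fin N) (Fin N) ℂ) * star (U₀ ⟨p.src, p.ν⟩ : Matrix (Fin N) (Fin N) ℂ) - 1)‖
      ≤ ‖((GaugeField.plaqHol U p : Matrix.specialUnitaryGroup (Fin N) ℂ) : Matrix (Fin N) (Fin N) ℂ)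
            * star ((GaugeField.plaqHol U₀ p : Matrix.specialUnitaryGroup (Fin N) ℂ) : Matrix (Fin N) (Fin N) ℂ) - 1‖
        + 2 * (‖(U ⟨p.src, p.μ⟩ : Matrix (Fin N) (Fin N) ℂ) * star (U₀ ⟨p.src, p.μ⟩ : Matrix (Fin N) (Fin N) ℂ) - 1‖
              + ‖(U ⟨p.src.shift p.μ, p.ν⟩ : Matrix (Fin N) (Fin N) ℂ) * star (U₀ ⟨p.src.shift p.μ, p.ν⟩ : Matrix (Fin N) (Fin N) ℂ) - 1‖
              + ‖(U ⟨p.src.shift p.ν, p.μ⟩ : Matrix (Fin N) (Fin N) ℂ) * star (U₀ ⟨p.src.shift p.ν, p.μ⟩ : Matrix (Fin N) (Fin N) ℂ) - 1‖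
              + ‖(U ⟨p.src, p.ν⟩ : Matrix (Fin N) (Fin N) ℂ) * star (U₀ ⟨p.src, p.ν⟩ : Matrix (Fin N) (Fin N) ℂ) - 1‖) ^ 2
        + 2 * ‖((GaugeField.plaqHol U₀ p : Matrix.specialUnitaryGroup (Fin N) ℂ) : Matrix (Fin N) (Fin N) ℂ) - 1‖
            * (‖(U ⟨p.src.shift p.ν, p.μ⟩ : Matrix (Fin N) (Fin N) ℂ) * star (U₀ ⟨p.src.shift p.ν, p.μ⟩ : Matrix (Fin N) (Fin N) ℂ) - 1‖
              + ‖(U ⟨p.src, p.ν⟩ : Matrix (Fin N) (Fin N) ℂ) * star (U₀ ⟨p.src, p.ν⟩ : Matrix (Fin N) (Fin N) ℂ) - 1‖) := by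
  have hr := norm_plaqHol_mul_star_bg_sub_one_sub_lin_le' U U₀ p
  have hc := norm_lin_sub_curl_le (U₀ ⟨p.src, p.μ⟩) (U₀ ⟨p.src.shift p.μ, p.ν⟩) (U₀ ⟨p.src.shift p.ν, p.μ⟩) (U₀ ⟨p.src, p.ν⟩)
    ((U ⟨p.src.shift p.ν, p.μ⟩ : Matrix (Fin N) (Fin N) ℂ) * star (U₀ ⟨p.src.shift p.ν, p.μ⟩ : Matrix (Fin N) (Fin N) ℂ) - 1)
    ((U ⟨p.src, p.ν⟩ : Matrix (Fin N) (Fin N) ℂ) * star (U₀ ⟨p.src, p.ν⟩ : Matrix (Fin N) (Fin N) ℂ) - 1)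
  rw [← plaqHol_eq_word U₀ p] at hc
  -- `C = (R − 1) − r − (L − C)`, `r = R − 1 − L`, `L − C = −((QY₃Q^* + P₀Y₄P₀^*) − (V₄Y₃V₄^* + Y₄))`
  refine norm_le_of_sub_of_sub hr hc ?_
  abel

/-- **HILBERT–SCHMIDT FORM, `SU(2)`**: with `‖Y(b)‖ ≤ s` at the four bonds and `‖U₀(∂p) − 1‖ ≤ a`,
`Σ_{jk}|C_p(Y)_{jk}|² ≤ 6‖R_p − 1‖² + (1536s² + 48a²)·Σ_{b∈∂p}‖Y(b)‖²`. [cite: Balaban1985Variational, (22)-(28) pp.281-282] -/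
theorem hs_covCurl_le (U U₀ : GaugeField P j (Matrix.specialUnitaryGroup (Fin 2) ℂ)) (p : Plaq P j) {a s : ℝ}
    (hE : ‖((GaugeField.plaqHol U₀ p : Matrix.specialUnitaryGroup (Fin 2) ℂ) : Matrix (Fin 2) (Fin 2) ℂ) - 1‖ ≤ a)
    (hδ : ∀ b : PBond P j, ‖(U b : Matrix (Fin 2) (Fin 2) ℂ) * star (U₀ b : Matrix (Fin 2) (Fin 2) ℂ) - 1‖ ≤ s) :
    ∑ i₁ : Fin 2, ∑ i₂ : Fin 2,
        ‖(((U ⟨p.src, p.μ⟩ : Matrix (Fin 2) (Fin 2) ℂ) * star (U₀ ⟨p.src, p.μ⟩ : Matrix (Fin 2) (Fin 2) ℂ) - 1)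
            + (U₀ ⟨p.src, p.μ⟩ : Matrix (Fin 2) (Fin 2) ℂ)
                * ((U ⟨p.src.shift p.μ, p.ν⟩ : Matrix (Fin 2) (Fin 2) ℂ) * star (U₀ ⟨p.src.shift p.μ, p.ν⟩ : Matrix (Fin 2) (Fin 2) ℂ) - 1)
                * star (U₀ ⟨p.src, p.μ⟩ : Matrix (Fin 2) (Fin 2) ℂ)
            - (U₀ ⟨p.src, p.ν⟩ : Matrix (Fin 2) (Fin 2) ℂ)
                * ((U ⟨p.src.shift p.ν, p.μ⟩ : Matrix (Fin 2) (Fin 2) ℂ) * star (U₀ ⟨p.src.shift p.ν, p.μ⟩ : Matrix (Fin 2) (Fin 2) ℂ) - 1)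
                * star (U₀ ⟨p.src, p.ν⟩ : Matrix (Fin 2) (Fin 2) ℂ)
            - ((U ⟨p.src, p.ν⟩ : Matrix (Fin 2) (Fin 2) ℂ) * star (U₀ ⟨p.src, p.ν⟩ : Matrix (Fin 2) (Fin 2) ℂ) - 1)) i₁ i₂‖ ^ 2
      ≤ 6 * ‖((GaugeField.plaqHol U p : Matrix.specialUnitaryGroup (Fin 2) ℂ) : Matrix (Fin 2) (Fin 2) ℂ)
              * star ((GaugeField.plaqHol U₀ p : Matrix.specialUnitaryGroup (Fin 2) ℂ) : Matrix (Fin 2) (Fin 2) ℂ) - 1‖ ^ 2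
        + (1536 * s ^ 2 + 48 * a ^ 2)
          * (‖(U ⟨p.src, p.μ⟩ : Matrix (Fin 2) (Fin 2) ℂ) * star (U₀ ⟨p.src, p.μ⟩ : Matrix (Fin 2) (Fin 2) ℂ) - 1‖ ^ 2
            + ‖(U ⟨p.src.shift p.μ, p.ν⟩ : Matrix (Fin 2) (Fin 2) ℂ) * star (U₀ ⟨p.src.shift p.μ, p.ν⟩ : Matrix (Fin 2) (Fin 2) ℂ) - 1‖ ^ 2
            + ‖(U ⟨p.src.shift p.ν, p.μ⟩ : Matrix (Fin 2) (Fin 2) ℂ) * star (U₀ ⟨p.src.shift p.ν, p.μ⟩ : Matrix (Fin 2) (Fin 2) ℂ) - 1‖ ^ 2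
            + ‖(U ⟨p.src, p.ν⟩ : Matrix (Fin 2) (Fin 2) ℂ) * star (U₀ ⟨p.src, p.ν⟩ : Matrix (Fin 2) (Fin 2) ℂ) - 1‖ ^ 2) := by
  have hC := norm_covCurl_le U U₀ p
  have h2 := sum_norm_sq_le_mul_opNorm_sq
    (((U ⟨p.src, p.μ⟩ : Matrix (Fin 2) (Fin 2) ℂ) * star (U₀ ⟨p.src, p.μ⟩ : Matrix (Fin 2) (Fin 2) ℂ) - 1)
            + (U₀ ⟨p.src, p.μ⟩ : Matrix (Fin 2) (Fin 2) ℂ)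
                * ((U ⟨p.src.shift p.μ, p.ν⟩ : Matrix (Fin 2) (Fin 2) ℂ) * star (U₀ ⟨p.src.shift p.μ, p.ν⟩ : Matrix (Fin 2) (Fin 2) ℂ) - 1)
                * star (U₀ ⟨p.src, p.μ⟩ : Matrix (Fin 2) (Fin 2) ℂ)
            - (U₀ ⟨p.src, p.ν⟩ : Matrix (Fin 2) (Fin 2) ℂ)
                * ((U ⟨p.src.shift p.ν, p.μ⟩ : Matrix (Fin 2) (Fin 2) ℂ) * star (U₀ ⟨p.src.shift p.ν, p.μ⟩ : Matrix (Fin 2) (Fin 2) ℂ) - 1)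
                * star (U₀ ⟨p.src, p.ν⟩ : Matrix (Fin 2) (Fin 2) ℂ)
            - ((U ⟨p.src, p.ν⟩ : Matrix (Fin 2) (Fin 2) ℂ) * star (U₀ ⟨p.src, p.ν⟩ : Matrix (Fin 2) (Fin 2) ℂ) - 1))
  have hb := hs_bookkeeping (norm_nonneg _) (norm_nonneg _) (norm_nonneg _) (norm_nonneg _) (norm_nonneg _) (norm_nonneg _)
    (hδ ⟨p.src, p.μ⟩) (hδ ⟨p.src.shift p.μ, p.ν⟩) (hδ ⟨p.src.shift p.ν, p.μ⟩) (hδ ⟨p.src, p.ν⟩) hE hC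
  rw [Nat.cast_ofNat] at h2
  linarith [h2, hb]

/-- **SUMMED AT THE d = 3 CARRIER** (incidence `4d = 12`): `Σ_p Σ_{jk}|C_p(Y)_{jk}|² ≤ 6Σ_p‖R_p − 1‖² + 12(1536s² + 48a²)Σ_b‖Y(b)‖²`, `a = εL^{−2(K−n)}`.
[cite: Balaban1985Variational, (22)-(28) pp.281-282] -/
theorem sum_hs_covCurl_le_T3 (F : T3Family) (n K : ℕ)
    (U U₀ : GaugeField (F.P K) 0 (Matrix.specialUnitaryGroup (Fin 2) ℂ)) {ε s : ℝ}
    (hU₀ : ∀ p : Plaq (F.P K) 0, dist1 (GaugeField.plaqHol U₀ p) ≤ ε * (((F.L : ℝ) ^ (K - n)) ^ 2)⁻¹)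
    (hδ : ∀ b : PBond (F.P K) 0, ‖(U b : Matrix (Fin 2) (Fin 2) ℂ) * star (U₀ b : Matrix (Fin 2) (Fin 2) ℂ) - 1‖ ≤ s) :
    ∑ p : Plaq (F.P K) 0, ∑ i₁ : Fin 2, ∑ i₂ : Fin 2,
        ‖(((U ⟨p.src, p.μ⟩ : Matrix (Fin 2) (Fin 2) ℂ) * star (U₀ ⟨p.src, p.μ⟩ : Matrix (Fin 2) (Fin 2) ℂ) - 1)
            + (U₀ ⟨p.src, p.μ⟩ : Matrix (Fin 2) (Fin 2) ℂ)
                * ((U ⟨p.src.shift p.μ, p.ν⟩ : Matrix (Fin 2) (Fin 2) ℂ) * star (U₀ ⟨p.src.shift p.μ, p.ν⟩ : Matrix (Fin 2) (Fin 2) ℂ) - 1)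
                * star (U₀ ⟨p.src, p.μ⟩ : Matrix (Fin 2) (Fin 2) ℂ)
            - (U₀ ⟨p.src, p.ν⟩ : Matrix (Fin 2) (Fin 2) ℂ)
                * ((U ⟨p.src.shift p.ν, p.μ⟩ : Matrix (Fin 2) (Fin 2) ℂ) * star (U₀ ⟨p.src.shift p.ν, p.μ⟩ : Matrix (Fin 2) (Fin 2) ℂ) - 1)
                * star (U₀ ⟨p.src, p.ν⟩ : Matrix (Fin 2) (Fin 2) ℂ)
            - ((U ⟨p.src, p.ν⟩ : Matrix (Fin 2) (Fin 2) ℂ) * star (U₀ ⟨p.src, p.ν⟩ : Matrix (Fin 2) (Fin 2) ℂ) - 1)) i₁ i₂‖ ^ 2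
      ≤ 6 * ∑ p : Plaq (F.P K) 0, ‖((GaugeField.plaqHol U p : Matrix.specialUnitaryGroup (Fin 2) ℂ) : Matrix (Fin 2) (Fin 2) ℂ)
              * star ((GaugeField.plaqHol U₀ p : Matrix.specialUnitaryGroup (Fin 2) ℂ) : Matrix (Fin 2) (Fin 2) ℂ) - 1‖ ^ 2
        + 12 * (1536 * s ^ 2 + 48 * (ε * (((F.L : ℝ) ^ (K - n)) ^ 2)⁻¹) ^ 2)
          * ∑ b : PBond (F.P K) 0, ‖(U b : Matrix (Fin 2) (Fin 2) ℂ) * star (U₀ b : Matrix (Fin 2) (Fin 2) ℂ) - 1‖ ^ 2 := by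
  set a : ℝ := ε * (((F.L : ℝ) ^ (K - n)) ^ 2)⁻¹ with ha_def
  have hper := fun p : Plaq (F.P K) 0 => hs_covCurl_le U U₀ p (hU₀ p) hδ
  have hsum := Finset.sum_le_sum fun p (_ : p ∈ (Finset.univ : Finset (Plaq (F.P K) 0))) => hper p
  rw [Finset.sum_add_distrib] at hsum
  have m1 : ∑ p : Plaq (F.P K) 0, 6 * ‖((GaugeField.plaqHol U p : Matrix.specialUnitaryGroup (Fin 2) ℂ) : Matrix (Fin 2) (Fin 2) ℂ)
              * star ((GaugeField.plaqHol U₀ p : Matrix.specialUnitaryGroup (Fin 2) ℂ) : Matrix (Fin 2) (Fin 2) ℂ) - 1‖ ^ 2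
      = 6 * ∑ p : Plaq (F.P K) 0, ‖((GaugeField.plaqHol U p : Matrix.specialUnitaryGroup (Fin 2) ℂ) : Matrix (Fin 2) (Fin 2) ℂ)
              * star ((GaugeField.plaqHol U₀ p : Matrix.specialUnitaryGroup (Fin 2) ℂ) : Matrix (Fin 2) (Fin 2) ℂ) - 1‖ ^ 2 := by
    rw [Finset.mul_sum]
  have m2 : ∑ p : Plaq (F.P K) 0, (1536 * s ^ 2 + 48 * a ^ 2)
          * (‖(U ⟨p.src, p.μ⟩ : Matrix (Fin 2) (Fin 2) ℂ) * star (U₀ ⟨p.src, p.μ⟩ : Matrix (Fin 2) (Fin 2) ℂ) - 1‖ ^ 2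
            + ‖(U ⟨p.src.shift p.μ, p.ν⟩ : Matrix (Fin 2) (Fin 2) ℂ) * star (U₀ ⟨p.src.shift p.μ, p.ν⟩ : Matrix (Fin 2) (Fin 2) ℂ) - 1‖ ^ 2
            + ‖(U ⟨p.src.shift p.ν, p.μ⟩ : Matrix (Fin 2) (Fin 2) ℂ) * star (U₀ ⟨p.src.shift p.ν, p.μ⟩ : Matrix (Fin 2) (Fin 2) ℂ) - 1‖ ^ 2
            + ‖(U ⟨p.src, p.ν⟩ : Matrix (Fin 2) (Fin 2) ℂ) * star (U₀ ⟨p.src, p.ν⟩ : Matrix (Fin 2) (Fin 2) ℂ) - 1‖ ^ 2)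
      = (1536 * s ^ 2 + 48 * a ^ 2) * ∑ p : Plaq (F.P K) 0,
          (‖(U ⟨p.src, p.μ⟩ : Matrix (Fin 2) (Fin 2) ℂ) * star (U₀ ⟨p.src, p.μ⟩ : Matrix (Fin 2) (Fin 2) ℂ) - 1‖ ^ 2
            + ‖(U ⟨p.src.shift p.μ, p.ν⟩ : Matrix (Fin 2) (Fin 2) ℂ) * star (U₀ ⟨p.src.shift p.μ, p.ν⟩ : Matrix (Fin 2) (Fin 2) ℂ) - 1‖ ^ 2
            + ‖(U ⟨p.src.shift p.ν, p.μ⟩ : Matrix (Fin 2) (Fin 2) ℂ) * star (U₀ ⟨p.src.shift p.ν, p.μ⟩ : Matrix (Fin 2) (Fin 2) ℂ) - 1‖ ^ 2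
            + ‖(U ⟨p.src, p.ν⟩ : Matrix (Fin 2) (Fin 2) ℂ) * star (U₀ ⟨p.src, p.ν⟩ : Matrix (Fin 2) (Fin 2) ℂ) - 1‖ ^ 2) := by
    rw [Finset.mul_sum]
  rw [m1, m2] at hsum
  have hinc := sum_plaq_bonds_le (P := F.P K) (j := 0)
    (fun b => ‖(U b : Matrix (Fin 2) (Fin 2) ℂ) * star (U₀ b : Matrix (Fin 2) (Fin 2) ℂ) - 1‖ ^ 2) (fun b => sq_nonneg _)
  have hd : ((F.P K).d : ℝ) = 3 := by norm_num [T3Family.P_d]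
  rw [hd] at hinc
  have hc0 : 0 ≤ 1536 * s ^ 2 + 48 * a ^ 2 := by positivity
  have herr := mul_le_mul_of_nonneg_left hinc hc0
  linarith [hsum, herr]

/-- **(ii) ⟹ (ii′): THE LINEAR-CURL POINCARÉ INEQUALITY OF A SUP-SMALL REPRESENTATIVE IMPLIES THE RELATIVE-CURVATURE ONE** (d = 3 carrier): if
`Σ_b‖Y_b‖² ≤ C_P·L^{2(K−n)}·Σ_p|C_p(Y)|²_HS` (gen 9's (ii)), `‖Y_b‖ ≤ s`, the background plaquettes lie within `εL^{−2(K−n)}` of `1`, and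
`12·C_P·L^{2(K−n)}·(1536s² + 48(εL^{−2(K−n)})²) ≤ ½`, then `Σ_b‖Y_b‖² ≤ 12C_P·L^{2(K−n)}·Σ_p‖R_p − 1‖²` (gen 10's (ii′) with `C_P′ = 12C_P`).
[cite: Balaban1985Variational, (141)-(143) p.299] -/
theorem relPoincare_of_curlPoincare_T3 (F : T3Family) (n K : ℕ)
    (U U₀ : GaugeField (F.P K) 0 (Matrix.specialUnitaryGroup (Fin 2) ℂ)) {ε s CP : ℝ} (hCP : 0 ≤ CP)
    (hU₀ : ∀ p : Plaq (F.P K) 0, dist1 (GaugeField.plaqHol U₀ p) ≤ ε * (((F.L : ℝ) ^ (K - n)) ^ 2)⁻¹)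
    (hδ : ∀ b : PBond (F.P K) 0, ‖(U b : Matrix (Fin 2) (Fin 2) ℂ) * star (U₀ b : Matrix (Fin 2) (Fin 2) ℂ) - 1‖ ≤ s)
    (hsmall : 12 * CP * ((F.L : ℝ) ^ (K - n)) ^ 2 * (1536 * s ^ 2 + 48 * (ε * (((F.L : ℝ) ^ (K - n)) ^ 2)⁻¹) ^ 2) ≤ 1 / 2)
    (hP : ∑ b : PBond (F.P K) 0, ‖(U b : Matrix (Fin 2) (Fin 2) ℂ) * star (U₀ b : Matrix (Fin 2) (Fin 2) ℂ) - 1‖ ^ 2 ≤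
      CP * ((F.L : ℝ) ^ (K - n)) ^ 2 * ∑ p : Plaq (F.P K) 0, ∑ i₁ : Fin 2, ∑ i₂ : Fin 2,
          ‖(((U ⟨p.src, p.μ⟩ : Matrix (Fin 2) (Fin 2) ℂ) * star (U₀ ⟨p.src, p.μ⟩ : Matrix (Fin 2) (Fin 2) ℂ) - 1)
              + (U₀ ⟨p.src, p.μ⟩ : Matrix (Fin 2) (Fin 2) ℂ)
                  * ((U ⟨p.src.shift p.μ, p.ν⟩ : Matrix (Fin 2) (Fin 2) ℂ) * star (U₀ ⟨p.src.shift p.μ, p.ν⟩ : Matrix (Fin 2) (Fin 2) ℂ) - 1)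
                  * star (U₀ ⟨p.src, p.μ⟩ : Matrix (Fin 2) (Fin 2) ℂ)
              - (U₀ ⟨p.src, p.ν⟩ : Matrix (Fin 2) (Fin 2) ℂ)
                  * ((U ⟨p.src.shift p.ν, p.μ⟩ : Matrix (Fin 2) (Fin 2) ℂ) * star (U₀ ⟨p.src.shift p.ν, p.μ⟩ : Matrix (Fin 2) (Fin 2) ℂ) - 1)
                  * star (U₀ ⟨p.src, p.ν⟩ : Matrix (Fin 2) (Fin 2) ℂ)
              - ((U ⟨p.src, p.ν⟩ : Matrix (Fin 2) (Fin 2) ℂ) * star (U₀ ⟨p.src, p.ν⟩ : Matrix (Fin 2) (Fin 2) ℂ) - 1)) i₁ i₂‖ ^ 2) :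
    ∑ b : PBond (F.P K) 0, ‖(U b : Matrix (Fin 2) (Fin 2) ℂ) * star (U₀ b : Matrix (Fin 2) (Fin 2) ℂ) - 1‖ ^ 2 ≤
      12 * CP * ((F.L : ℝ) ^ (K - n)) ^ 2 * ∑ p : Plaq (F.P K) 0,
        ‖((GaugeField.plaqHol U p : Matrix.specialUnitaryGroup (Fin 2) ℂ) : Matrix (Fin 2) (Fin 2) ℂ)
            * star ((GaugeField.plaqHol U₀ p : Matrix.specialUnitaryGroup (Fin 2) ℂ) : Matrix (Fin 2) (Fin 2) ℂ) - 1‖ ^ 2 := by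
  have hC := sum_hs_covCurl_le_T3 F n K U U₀ hU₀ hδ
  have hL2 : (0 : ℝ) ≤ ((F.L : ℝ) ^ (K - n)) ^ 2 := sq_nonneg _
  have hk : 0 ≤ CP * ((F.L : ℝ) ^ (K - n)) ^ 2 := mul_nonneg hCP hL2
  have h1 := hP.trans (mul_le_mul_of_nonneg_left hC hk)
  -- `Y ≤ k(6R + 12cY)` and `12kc ≤ ½` ⇒ `Y ≤ 12kR`
  set Ysum := ∑ b : PBond (F.P K) 0, ‖(U b : Matrix (Fin 2) (Fin 2) ℂ) * star (U₀ b : Matrix (Fin 2) (Fin 2) ℂ) - 1‖ ^ 2 with hY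
  set Rsum := ∑ p : Plaq (F.P K) 0, ‖((GaugeField.plaqHol U p : Matrix.specialUnitaryGroup (Fin 2) ℂ) : Matrix (Fin 2) (Fin 2) ℂ)
            * star ((GaugeField.plaqHol U₀ p : Matrix.specialUnitaryGroup (Fin 2) ℂ) : Matrix (Fin 2) (Fin 2) ℂ) - 1‖ ^ 2 with hR
  have hY0 : 0 ≤ Ysum := Finset.sum_nonneg fun b _ => sq_nonneg _
  have hR0 : 0 ≤ Rsum := Finset.sum_nonneg fun p _ => sq_nonneg _
  have h2 : CP * ((F.L : ℝ) ^ (K - n)) ^ 2 * (12 * (1536 * s ^ 2 + 48 * (ε * (((F.L : ℝ) ^ (K - n)) ^ 2)⁻¹) ^ 2) * Ysum) ≤ (1 / 2) * Ysum := by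
    have := mul_le_mul_of_nonneg_right hsmall hY0
    linarith [this]
  nlinarith [h1, h2, hk, hR0, hY0]

end Summit.QuantumFields.YangMills.Theorems.Prop7RelPoincareOfCurl

end
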